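import Summits.SmoothPoincare4.SmoothPoincare4.Theses.CongruenceShadows
import Summits.SmoothPoincare4.SmoothPoincare4.Theorems.ShadowApproximation.Negative.ShadowsOnlyFalse
import Summits.SmoothPoincare4.SmoothPoincare4.Theorems.CongruenceShadowsAbelianShadowStandardCutLagrangian
import Summits.SmoothPoincare4.SmoothPoincare4.Theorems.CongruenceShadowsShadowApproximationStubAbelianGenusClass
import Summits.SmoothPoincare4.SmoothPoincare4.Theorems.CongruenceShadowsShadowApproximationStubAutAbelianizeSymplectic
import Summits.SmoothPoincare4.SmoothPoincare4.Theorems.CongruenceShadowsShadowApproximationStubGoeritzRealisationThree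
import Summits.SmoothPoincare4.SmoothPoincare4.Theorems.CongruenceShadowsShadowApproximationStubGoeritzRealisationPos
import Summits.SmoothPoincare4.SmoothPoincare4.Theorems.CongruenceShadowsShadowApproximationStubLayerStepZero
import Summits.SmoothPoincare4.SmoothPoincare4.Theorems.CongruenceShadowsShadowApproximationStubLayerStepOneZero
import Summits.SmoothPoincare4.SmoothPoincare4.Theorems.CongruenceShadowsShadowApproximationStubLayerStepZeroOne
import Summits.SmoothPoincare4.SmoothPoincare4.Theorems.CongruenceShadowsShadowApproximationStubLayerStepTwoZero
import Summits.SmoothPoincare4.SmoothPoincare4.Theorems.CongruenceShadowsShadowApproximationStubLayerStepZeroTwo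
import Summits.SmoothPoincare4.SmoothPoincare4.Theorems.CongruenceShadowsShadowApproximationStubNilpotentLayerStepOfCore
import Summits.SmoothPoincare4.SmoothPoincare4.Theorems.CongruenceShadowsShadowApproximationStubJohnsonClosedGateReduction
import Literature.Topology.FourManifolds.SurfaceGroupAbelianisationKernels
import Literature.Topology.FourManifolds.SurfaceGroupHomology
import Literature.Algebra.Lie.SurfaceLieAlgebra
import HarnessLib
import HarnessLib.Audit

/-!
# Line `nilpotent-genus-class` for crux `CongruenceShadows.ShadowApproximation` (stmt-SmoothPoincare4-14595)

Skeleton v7 (line LEAD prover-line-stmt-SmoothPoincare4-14595-c1-0, continuing a1; reshapes r1–r4 of the crux-plan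
skeleton `Lines/nilpotent-genus-class.lean`, idea `nilpotent-genus-class`, triage r1-2 / r1-3 pass):
**genus versus class in the nilpotent tower.** Truncate the approximation problem modulo
`γ_{c+2} S` (`γ m c := (⊤ : Subgroup S).lowerCentralSeries (c+1)`, so `γ m 0 = [S,S]` is the ABELIAN
level). Keep the Waldhausen pair `(N 0, N 1)` EXACT throughout (solutions are sought in the Goeritz
group `A ∩ B = Stab_{Aut S}(N 0, N 1)` of the standard genus-`3k` splitting of `#ᵏ S¹×S²`), make slot
`2` standard modulo `γ`, level by level; the 4-d depth sits in the passage `c → ∞`.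

Notation (existing declarations only): `S m = SurfaceGroup (3+3m)`, `N m = s4Kernels.stabilizeIter m`,
`γ m c` as above, `H₁ = (surfaceGen (3+3m) → ℤ)` with `SurfaceGroup.abelianize` and the intersection
form `symplForm`, `Λ m i = span {δ_y : y ∈ s4CutSystem m i}` the coordinate Lagrangian of slot `i`
(`= [N m i]` by the landed `span_image_stabilizeIter`).

RESHAPE r1 (what changed w.r.t. the planner's skeleton, and why). Every stub is now stated in TREE
VOCABULARY ONLY (explicit signatures, no line-local definition), so that each can be landed verbatim as
a `--supports` Theorems file. The planner's Stub 2 (GS₀, "lift `φ̄ ∈ Stab(L₀,L₁)` to the Goeritz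
group modulo `[S,S]`") is split by CONTENT into (2a) `stub_autAbelianizeSymplectic` — every
automorphism of `S_g` acts on `H₁` by a `±`-symplectic linear automorphism (Literature-grade, all
`g`; needed because only `±`-isometries are realisable) — and the REALISATION of `±`-isometries
stabilising `Λ₀, Λ₁` by Goeritz elements, (2b) `stub_goeritzRealisationThree` at genus `3` and (2c)
`stub_goeritzRealisationPos` at genus `3+3m`, `m ≥ 1` (which receives (2b) as a hypothesis: block
sums). The planner's Stub 3 (layer step, `∀ (m,c)`) is split into its FIRST INSTANCE (3a)
`stub_layerStepZero` (`(m,c) = (0,0)`: abelian → 2-step at genus 3, mechanism = degree-1 Lie gate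
identity + Goeritz–Johnson realisation; receives (2a),(2b) as hypotheses) and (3b)
`stub_nilpotentLayerStep` for `(m,c) ≠ (0,0)` (receives (2a) and realisation at all `m`). Stub 1 is
stated without the unused `Pairs`/`Shadows` hypotheses (it is the landed route item
`AbelianShadowStandard`, slot-normalised). Stub 4 (residual) unchanged. 7 stubs = stubs_max.

Chain (each arrow a registered stub; all glue proved in this file, sorries ONLY inside `stub_*`):

  crux hypotheses for `K` —[proved: slot-normalisation by `hW 0 1`, transport]→ WLOG `K 0 = N 0`,
  `K 1 = N 1` —[ABELIAN LEVEL = Stub 1 (φ with φ(Nᵢγ₂) = Nᵢγ₂, φ(N₂γ₂) = K₂γ₂) + Stub 2a (φ̄ is a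
  ±-isometry `F` of `H₁`) + glue (`F(Λ₀) = Λ₀`, `F(Λ₁) = Λ₁`) + Stubs 2b/2c (some `x ∈ A∩B` induces
  `F`) + glue (`x ≡ φ (mod γ₂ = ker ab)`)]→ `x₀ ∈ A∩B` with `x₀(N 2)·γ₂ = K 2·γ₂`
  —[LAYER STEPS = Stub 3a at `(0,0)`, Stub 3b elsewhere; induction `levelSolution_all` proved here]→
  for every `c` some `x_c ∈ A∩B` with `x_c(N 2)·γ_{c+2} = K 2·γ_{c+2}`
  —[`c → ∞` = Stub 4 `stub_johnsonClosedGate` (the honest residual)]→ `Iso N K`.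

`ShadowApproximation_of : …CongruenceShadows.ShadowApproximation` is proved at the end from the
seven stubs with NO hypotheses.

Disproof.lean (cdisprove gen 3 v7, re-read 2026-08-16T14:00Z) honoured: §3 — `IsGroupTrisection`
(with `Pairs`) is an explicit hypothesis of Stubs 1, 3a, 3b, 4 and is USED at Stub 4 (certificate
`johnsonClosedGate_false_without_isGroupTrisection` below, sorry-free: the junk triple has `x_c = id`
for all `c`, yet `¬ Iso`); §6/§8 (units) — no stub lifts a level symmetry `ψ_M`; the `Ẑˣ`-scalars are
absorbed (Stub 1 produces ONE integral `φ`; Stub 2a pins `φ̄ ∈ Sp±`); §7 — the residual Stub 4 is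
exactly the `c`-dependence of `x_c`; §9/§10 (class-2/3 symmetry computations, Alexander units) bear
on Stubs 3a/3b (Goeritz–Johnson realisation), recorded in the lead's NOTES. §2 sandwich respected:
Stubs 1–3 are implied by the crux; Stub 4 carries the 4-d depth and is NOT the crux verbatim.
-/

noncomputable section

set_option linter.dupNamespace false

open Literature.Topology.FourManifolds Literature.Algebra.Lie Multiplicative
open Summit.SmoothPoincare4.SmoothPoincare4.Theses.CongruenceShadows

namespace Summit.SmoothPoincare4.SmoothPoincare4.Cruxes.ShadowApproximation.NilpotentGenusClass

/-! ## 0. Notation and sorry-free transport lemmas -/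

/-- `S_g` at the crux's genus `g = 3 + 3m`. -/
abbrev S (m : ℕ) : Type := SurfaceGroup (3 + 3 * m)

/-- The standard kernel triple `N = s4Kernels # … # s4Kernels` of genus `3 + 3m`. -/
abbrev N (m : ℕ) : TrisectionKernels (3 + 3 * m) := s4Kernels.stabilizeIter m

/-- `γ m c = γ_{c+2}(S)` (1-indexed lower central series): `(⊤).lowerCentralSeries (c+1)`;
`γ m 0 = [S,S]` is the abelian level. -/
abbrev γ (m c : ℕ) : Subgroup (S m) := (⊤ : Subgroup (S m)).lowerCentralSeries (c + 1)

/-- `H₁(S; ℤ) = ℤ^{2g}` in the letter basis. -/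
abbrev H (m : ℕ) : Type := surfaceGen (3 + 3 * m) → ℤ

/-- The Hurewicz map `S ↠ H₁`, additively. -/
abbrev ab (m : ℕ) (s : S m) : H m := toAdd (SurfaceGroup.abelianize (3 + 3 * m) s)

/-- The coordinate Lagrangian `Λᵢ = span {δ_y : y ∈ s4CutSystem m i}` of slot `i`. -/
abbrev Λ (m : ℕ) (i : Fin 3) : Submodule ℤ (H m) :=
  Submodule.span ℤ ((fun y => (Pi.single y (1 : ℤ) : surfaceGen (3 + 3 * m) → ℤ)) '' s4CutSystem m i)

/-- The crux's Waldhausen normalisation `hW`: each pair of slots simultaneously standard. -/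
def Pairs (m : ℕ) (K : TrisectionKernels (3 + 3 * m)) : Prop :=
  ∀ i j : Fin 3, i ≠ j → ∃ α : S m ≃* S m,
    (N m i).map α.toMonoidHom = K i ∧ (N m j).map α.toMonoidHom = K j

/-- The crux's shadow hypothesis `hS`: standard shadows in every characteristic finite quotient. -/
def Shadows (m : ℕ) (K : TrisectionKernels (3 + 3 * m)) : Prop :=
  ∀ M : Subgroup (S m), M.Characteristic → M.FiniteIndex →
    ∃ ψ : S m ≃* S m, ∀ i : Fin 3, (N m i ⊔ M).map ψ.toMonoidHom = K i ⊔ M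

/-- A LEVEL-`c` SOLUTION for a slot-normalised `K`: a Goeritz element `x ∈ A∩B`
(`x(N 0) = N 0`, `x(N 1) = N 1`) carrying `N 2` onto `K 2` modulo `γ_{c+2}`. -/
def LevelSolution (m c : ℕ) (K : TrisectionKernels (3 + 3 * m)) : Prop :=
  ∃ x : S m ≃* S m, (N m 0).map x.toMonoidHom = N m 0 ∧ (N m 1).map x.toMonoidHom = N m 1 ∧
    (N m 2 ⊔ γ m c).map x.toMonoidHom = K 2 ⊔ γ m c

/-- READ-BACK: the crux is literally `∀ m K, IsGroupTrisection → Pairs → Shadows → Iso N K`. -/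
theorem shadowApproximation_iff :
    ShadowApproximation ↔ ∀ (m : ℕ) (K : TrisectionKernels (3 + 3 * m)),
      IsGroupTrisection (3 + 3 * m) (m + 1) (PUnit : Type) K → Pairs m K → Shadows m K →
        TrisectionKernels.Iso (N m) K :=
  Iff.rfl

section transport

variable {G : Type*} [Group G]

/-- `H ↦ H.map` along a composite of automorphisms. -/
theorem map_trans (e₁ e₂ : G ≃* G) (P : Subgroup G) :
    P.map (e₁.trans e₂).toMonoidHom = (P.map e₁.toMonoidHom).map e₂.toMonoidHom := by
  rw [Subgroup.map_map]
  rfl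

/-- `e⁻¹` undoes `e` on subgroups. -/
theorem map_map_symm (e : G ≃* G) (P : Subgroup G) :
    (P.map e.toMonoidHom).map e.symm.toMonoidHom = P := by
  ext x
  simp

/-- `e` undoes `e⁻¹` on subgroups. -/
theorem map_symm_map (e : G ≃* G) (P : Subgroup G) :
    (P.map e.symm.toMonoidHom).map e.toMonoidHom = P := by
  ext x
  simp

/-- If `e(P) = Q` then `e⁻¹(Q) = P`. -/
theorem map_symm_of_map (e : G ≃* G) {P Q : Subgroup G} (h : P.map e.toMonoidHom = Q) :
    Q.map e.symm.toMonoidHom = P := by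
  rw [← h, map_map_symm]

/-- An automorphism maps `⊤` onto `⊤`. -/
theorem map_top_equiv (ψ : G ≃* G) : (⊤ : Subgroup G).map ψ.toMonoidHom = ⊤ := by
  rw [← MonoidHom.range_eq_map, MonoidHom.range_eq_top.2 ψ.surjective]

/-- The lower central series is invariant under automorphisms (`map_lowerCentralSeries`). -/
theorem map_lcs_equiv (ψ : G ≃* G) (n : ℕ) :
    ((⊤ : Subgroup G).lowerCentralSeries n).map ψ.toMonoidHom = (⊤ : Subgroup G).lowerCentralSeries n := by
  rw [Subgroup.map_lowerCentralSeries, map_top_equiv]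

/-- CONGRUENCE ⟹ EQUAL IMAGES MODULO `M`: if `x ≡ φ (mod M)` pointwise (`x s · (φ s)⁻¹ ∈ M`), then
`x(P)·M ⊆ φ(P)·M`. -/
theorem map_le_of_congr {M : Subgroup G} {x φ : G ≃* G} (h : ∀ s, x s * (φ s)⁻¹ ∈ M)
    (P : Subgroup G) : P.map x.toMonoidHom ≤ P.map φ.toMonoidHom ⊔ M := by
  rintro _ ⟨s, hs, rfl⟩
  have e : x.toMonoidHom s = (x s * (φ s)⁻¹) * φ.toMonoidHom s := by simp
  rw [e, sup_comm]
  exact Subgroup.mul_mem_sup (h s) (Subgroup.mem_map_of_mem _ hs)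

/-- … hence `x(P)·M = φ(P)·M`. -/
theorem map_sup_congr {M : Subgroup G} {x φ : G ≃* G} (h : ∀ s, x s * (φ s)⁻¹ ∈ M)
    (P : Subgroup G) : P.map x.toMonoidHom ⊔ M = P.map φ.toMonoidHom ⊔ M :=
  le_antisymm (sup_le (map_le_of_congr h P) le_sup_right)
    (sup_le (map_le_of_congr (fun s => by simpa using M.inv_mem (h s)) P) le_sup_right)

end transport

/-- `γ` is `Aut S`-invariant. -/
theorem map_γ (m c : ℕ) (ψ : S m ≃* S m) : (γ m c).map ψ.toMonoidHom = γ m c :=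
  map_lcs_equiv ψ (c + 1)

variable {g : ℕ}

/-- **`Aut S_g`-invariance of the group-trisection property** (isomorphic kernel triples have
isomorphic cubes of quotients, via `QuotientGroup.congr`). -/
theorem isGroupTrisection_map {k : ℕ} {G : Type*} [Group G] {K : TrisectionKernels g}
    (hK : IsGroupTrisection g k G K) (α : SurfaceGroup g ≃* SurfaceGroup g) :
    IsGroupTrisection g k G (fun i => (K i).map α.toMonoidHom) := by
  have hsurj : Function.Surjective (α : SurfaceGroup g →* SurfaceGroup g) := α.surjective
  have himg : ∀ i, ((K i).map α.toMonoidHom : Set (SurfaceGroup g)) = α '' (K i) := fun i =>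
    Subgroup.coe_map _ _
  have hnc : ∀ s : Set (SurfaceGroup g),
      (Subgroup.normalClosure s).map (α : SurfaceGroup g →* SurfaceGroup g) =
        Subgroup.normalClosure (α '' s) := fun s =>
    Subgroup.map_normalClosure s _ hsurj
  refine ⟨fun i => (hK.normal i).map α.toMonoidHom α.surjective, fun i => ?_, fun i j hij => ?_, ?_⟩
  · refine (hK.free_quotient i).of_mulEquiv (QuotientGroup.congr _ _ α ?_)
    simp only [hnc, himg]
  · refine (hK.free_pairQuotient i j hij).of_mulEquiv (QuotientGroup.congr _ _ α ?_)
    simp only [hnc, himg, Set.image_union]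
  · obtain ⟨e⟩ := hK.triple
    refine ⟨(QuotientGroup.congr _ _ α ?_).symm.trans e⟩
    simp only [hnc, himg, Set.image_iUnion]

variable {m : ℕ}

/-- Transport of `Pairs` along `β ∈ Aut S`. -/
theorem pairs_transport (β : S m ≃* S m) {K : TrisectionKernels (3 + 3 * m)} (hW : Pairs m K) :
    Pairs m (fun i => (K i).map β.toMonoidHom) := by
  intro i j hij
  obtain ⟨α, hi, hj⟩ := hW i j hij
  exact ⟨α.trans β, by rw [map_trans, hi], by rw [map_trans, hj]⟩

/-- Transport of `Shadows` along `β ∈ Aut S` (characteristic subgroups are `Aut S`-invariant). -/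
theorem shadows_transport (β : S m ≃* S m) {K : TrisectionKernels (3 + 3 * m)} (hS : Shadows m K) :
    Shadows m (fun i => (K i).map β.toMonoidHom) := by
  intro M hM hMf
  obtain ⟨ψ, hψ⟩ := hS M hM hMf
  refine ⟨ψ.trans β, fun i => ?_⟩
  rw [map_trans, hψ i, Subgroup.map_sup, (Subgroup.characteristic_iff_map_eq.mp hM) β]

/-- Transport of the conclusion: `N ≅ β⁻¹ • K` implies `N ≅ K`. -/
theorem iso_transport (β : S m ≃* S m) {K : TrisectionKernels (3 + 3 * m)}
    (h : TrisectionKernels.Iso (N m) (fun i => (K i).map β.symm.toMonoidHom)) :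
    TrisectionKernels.Iso (N m) K := by
  obtain ⟨α, hα⟩ := h
  refine ⟨α.trans β, fun i => ?_⟩
  rw [map_trans, hα i]
  exact map_symm_map β (K i)

/-- Non-vacuity of the level notion: the standard triple has the identity as level-`c` solution. -/
theorem levelSolution_std (m c : ℕ) : LevelSolution m c (N m) :=
  ⟨MulEquiv.refl _, by simp, by simp, by simp⟩

/-! ## 1. The named statements of the line (local abbreviations of the REGISTERED stub signatures)

Each `def` below is, up to unfolding `S`, `N`, `γ`, `H`, `ab`, `Λ`, `Pairs`, `Shadows`,
`LevelSolution`, literally the type of the corresponding `stub_*` theorem of §2 (which is written out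
in tree vocabulary so that it can be landed verbatim as a `--supports` file). -/

/-- Stub 1 · ArithGate₀ (= route item `AbelianShadowStandard`, slot-normalised): for a slot-normalised
group trisection `K = (N 0, N 1, K 2)` of `{1}` some `φ ∈ Aut S` stabilises `N 0·γ₂`, `N 1·γ₂` and
carries `N 2·γ₂` to `K 2·γ₂`. -/
def AbelianGenusClass : Prop :=
  ∀ (m : ℕ) (K : TrisectionKernels (3 + 3 * m)),
    IsGroupTrisection (3 + 3 * m) (m + 1) (PUnit : Type) K → K 0 = N m 0 → K 1 = N m 1 →
    ∃ φ : S m ≃* S m,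
      (N m 0 ⊔ γ m 0).map φ.toMonoidHom = N m 0 ⊔ γ m 0 ∧
      (N m 1 ⊔ γ m 0).map φ.toMonoidHom = N m 1 ⊔ γ m 0 ∧
      (N m 2 ⊔ γ m 0).map φ.toMonoidHom = K 2 ⊔ γ m 0

/-- Stub 2a · every automorphism of the surface group `S_g` acts on `H₁ = ℤ^{2g}` by a
`±`-symplectic linear automorphism (`im(Aut S_g → GL_{2g}(ℤ)) ⊆ Sp±(2g, ℤ)`; classical: Nielsen /
Dehn–Baer; algebraically via `γ₂/γ₃ ≅ Λ²H/⟨ω⟩`, Labute). -/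
def AutSymplectic : Prop :=
  ∀ (g : ℕ) (φ : SurfaceGroup g ≃* SurfaceGroup g),
    ∃ (F : (surfaceGen g → ℤ) ≃ₗ[ℤ] (surfaceGen g → ℤ)) (ε : ℤ), (ε = 1 ∨ ε = -1) ∧
      (∀ s : SurfaceGroup g,
        toAdd (SurfaceGroup.abelianize g (φ s)) = F (toAdd (SurfaceGroup.abelianize g s))) ∧
      ∀ u v : surfaceGen g → ℤ, symplForm (F u) (F v) = ε * symplForm u v

/-- Stubs 2b/2c · GOERITZ REALISATION at genus `3+3m`: every `±`-isometry `F` of `H₁` stabilising the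
coordinate Lagrangians `Λ₀, Λ₁` is induced by a Goeritz element `x ∈ A∩B = Stab(N 0) ∩ Stab(N 1)`
(GS₀: `im(A∩B → Sp±) = Stab_{Sp±}(Λ₀, Λ₁)`, the Goeritz group of the standard genus-`3k` Heegaard
splitting of `#ᵏ S¹×S²` realises the whole integral pair-stabiliser). -/
def GoeritzRealisation (m : ℕ) : Prop :=
  ∀ (F : H m ≃ₗ[ℤ] H m) (ε : ℤ), (ε = 1 ∨ ε = -1) →
    (∀ u v : H m, symplForm (F u) (F v) = ε * symplForm u v) →
    (Λ m 0).map F.toLinearMap = Λ m 0 → (Λ m 1).map F.toLinearMap = Λ m 1 →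
    ∃ x : S m ≃* S m, (N m 0).map x.toMonoidHom = N m 0 ∧ (N m 1).map x.toMonoidHom = N m 1 ∧
      ∀ s : S m, ab m (x s) = F (ab m s)

/-- Stubs 3a/3b · the LAYER STEP at `(m, c)`: a slot-normalised group trisection `K` of `{1}` with
standard pairs and shadows whose slot `2` is standard modulo `γ_{c+2}` becomes standard modulo
`γ_{c+3}` after a Goeritz element. -/
def LayerStepAt (m c : ℕ) : Prop :=
  ∀ (K : TrisectionKernels (3 + 3 * m)),
    IsGroupTrisection (3 + 3 * m) (m + 1) (PUnit : Type) K → K 0 = N m 0 → K 1 = N m 1 →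
    Pairs m K → Shadows m K → K 2 ⊔ γ m c = N m 2 ⊔ γ m c →
    ∃ y : S m ≃* S m, (N m 0).map y.toMonoidHom = N m 0 ∧ (N m 1).map y.toMonoidHom = N m 1 ∧
      (N m 2 ⊔ γ m (c + 1)).map y.toMonoidHom = K 2 ⊔ γ m (c + 1)

/-- Stub 4 · the residual: level solutions at every nilpotent level ⟹ `Iso N K`. -/
def JohnsonClosedGate : Prop :=
  ∀ (m : ℕ) (K : TrisectionKernels (3 + 3 * m)),
    IsGroupTrisection (3 + 3 * m) (m + 1) (PUnit : Type) K → K 0 = N m 0 → K 1 = N m 1 →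
    Pairs m K → Shadows m K → (∀ c : ℕ, LevelSolution m c K) →
    TrisectionKernels.Iso (N m) K

/-! ## 2. Registered stubs (tree vocabulary only; sorries live ONLY here) -/

-- (Stubs 1, 2a, 2b, 2c, 3a are LANDED Theorems files, imported above; see §3.)
-- RESHAPE r4 (lead c1, 2026-08-16T23:50Z): (0,2) landed (p131563 + 9 helper files); `stub_nilpotentLayerStep`
-- split per worker W-D's certificate-backed verdict into `stub_layerStepZeroThree` (0,3), `stub_layerStepBlockZero`
-- ((m,0), m ≥ 3) and `stub_layerStepResidualFamily` (the rest); uniform reduction `helper_layerStepOfCore` landed (p127510).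

-- (Stubs 3b-i (1,0) and 3b-ii (0,1) are LANDED Theorems files, imported above; see §3.)

-- (Stub 3b-iii (2,0) is a LANDED Theorems file, imported above; see §3.)

-- (Stub 3b-iv (0,2) is a LANDED Theorems file (p131563, this seat), imported above; see §3.)

/-- STUB 3b-v `stub_layerStepZeroThree` (RESHAPE r4, this seat: the layer step at `(m,c) = (0,3)`: 4-step → 5-step
nilpotent at genus 3; given Stub 2a and Goeritz realisation at all genera. CERTIFICATE (worker W-D,
`REPORT.md`/`CERTIFICATE_0_3.md` attached to the item): the constrained lattice `Λ₄ ⊂ L₅(ℤ³)³` has rank 28; Lie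
brackets of lower realisers reach index `2⁸` only; relation products close it — `[Λ₄ : R₄] = 1` with 34 explicit Goeritz
words (20–406 seeds) in `Stab N₀ ∩ Stab N₁ ∩ 𝒥₄`, independently re-verified. Lean route: data add on `𝒥₄` + degree-5
Magnus evaluation of the words (size XL, no new mathematics).) -/
theorem stub_layerStepZeroThree :
    (∀ (g : ℕ) (φ : SurfaceGroup g ≃* SurfaceGroup g),
      ∃ (F : (surfaceGen g → ℤ) ≃ₗ[ℤ] (surfaceGen g → ℤ)) (ε : ℤ), (ε = 1 ∨ ε = -1) ∧
        (∀ s : SurfaceGroup g,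
          toAdd (SurfaceGroup.abelianize g (φ s)) = F (toAdd (SurfaceGroup.abelianize g s))) ∧
        ∀ u v : surfaceGen g → ℤ, symplForm (F u) (F v) = ε * symplForm u v) →
    (∀ (m : ℕ) (F : (surfaceGen (3 + 3 * m) → ℤ) ≃ₗ[ℤ] (surfaceGen (3 + 3 * m) → ℤ)) (ε : ℤ),
      (ε = 1 ∨ ε = -1) →
      (∀ u v : surfaceGen (3 + 3 * m) → ℤ, symplForm (F u) (F v) = ε * symplForm u v) →
      (Submodule.span ℤ ((fun y => (Pi.single y (1 : ℤ) : surfaceGen (3 + 3 * m) → ℤ)) ''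
          s4CutSystem m 0)).map F.toLinearMap =
        Submodule.span ℤ ((fun y => (Pi.single y (1 : ℤ) : surfaceGen (3 + 3 * m) → ℤ)) ''
          s4CutSystem m 0) →
      (Submodule.span ℤ ((fun y => (Pi.single y (1 : ℤ) : surfaceGen (3 + 3 * m) → ℤ)) ''
          s4CutSystem m 1)).map F.toLinearMap =
        Submodule.span ℤ ((fun y => (Pi.single y (1 : ℤ) : surfaceGen (3 + 3 * m) → ℤ)) ''
          s4CutSystem m 1) →
      ∃ x : SurfaceGroup (3 + 3 * m) ≃* SurfaceGroup (3 + 3 * m),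
        (s4Kernels.stabilizeIter m 0).map x.toMonoidHom = s4Kernels.stabilizeIter m 0 ∧
        (s4Kernels.stabilizeIter m 1).map x.toMonoidHom = s4Kernels.stabilizeIter m 1 ∧
        ∀ s : SurfaceGroup (3 + 3 * m),
          toAdd (SurfaceGroup.abelianize (3 + 3 * m) (x s)) =
            F (toAdd (SurfaceGroup.abelianize (3 + 3 * m) s))) →
    ∀ (K : TrisectionKernels (3 + 3 * 0)),
      IsGroupTrisection (3 + 3 * 0) (0 + 1) (PUnit : Type) K →
      K 0 = s4Kernels.stabilizeIter 0 0 → K 1 = s4Kernels.stabilizeIter 0 1 →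
      (∀ i j : Fin 3, i ≠ j → ∃ α : SurfaceGroup (3 + 3 * 0) ≃* SurfaceGroup (3 + 3 * 0),
        (s4Kernels.stabilizeIter 0 i).map α.toMonoidHom = K i ∧
          (s4Kernels.stabilizeIter 0 j).map α.toMonoidHom = K j) →
      (∀ M : Subgroup (SurfaceGroup (3 + 3 * 0)), M.Characteristic → M.FiniteIndex →
        ∃ ψ : SurfaceGroup (3 + 3 * 0) ≃* SurfaceGroup (3 + 3 * 0), ∀ i : Fin 3,
          (s4Kernels.stabilizeIter 0 i ⊔ M).map ψ.toMonoidHom = K i ⊔ M) →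
      K 2 ⊔ (⊤ : Subgroup (SurfaceGroup (3 + 3 * 0))).lowerCentralSeries (1 + 1 + 1 + 1) =
        s4Kernels.stabilizeIter 0 2 ⊔ (⊤ : Subgroup (SurfaceGroup (3 + 3 * 0))).lowerCentralSeries (1 + 1 + 1 + 1) →
      ∃ y : SurfaceGroup (3 + 3 * 0) ≃* SurfaceGroup (3 + 3 * 0),
        (s4Kernels.stabilizeIter 0 0).map y.toMonoidHom = s4Kernels.stabilizeIter 0 0 ∧
        (s4Kernels.stabilizeIter 0 1).map y.toMonoidHom = s4Kernels.stabilizeIter 0 1 ∧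
        (s4Kernels.stabilizeIter 0 2 ⊔ (⊤ : Subgroup (SurfaceGroup (3 + 3 * 0))).lowerCentralSeries (1 + 1 + 1 + 1 + 1)).map
            y.toMonoidHom =
          K 2 ⊔ (⊤ : Subgroup (SurfaceGroup (3 + 3 * 0))).lowerCentralSeries (1 + 1 + 1 + 1 + 1) := by
  sorry

/-- STUB 3b-vi `stub_layerStepBlockZero` (RESHAPE r4: the layer step at `(m, 0)` for every `m ≥ 3` — abelian → 2-step at
genus `3+3m`; given Stub 2a and Goeritz realisation at all genera. MECHANISM (worker W-D, `REPORT.md` §3): at level 1 the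
honest lattice is `span{e_{abc} : not a ≡ b ≡ c ≡ 1, not a ≡ b ≡ c ≡ 2 (mod 3)} ⊂ Λ³ℤ^g`, every honest triple lies in
`≤ 3` blocks, and block-permutation conjugates of the landed genus-9 base realisers (…StubLayerStepTwoZero) realise it:
index 1 re-verified at genus 12 and 15 with `≤ 3`-block generators; so the family is ONE uniform transplant/equivariance
lemma + the genus-9 table (size L).) -/
theorem stub_layerStepBlockZero :
    (∀ (g : ℕ) (φ : SurfaceGroup g ≃* SurfaceGroup g),
      ∃ (F : (surfaceGen g → ℤ) ≃ₗ[ℤ] (surfaceGen g → ℤ)) (ε : ℤ), (ε = 1 ∨ ε = -1) ∧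
        (∀ s : SurfaceGroup g,
          toAdd (SurfaceGroup.abelianize g (φ s)) = F (toAdd (SurfaceGroup.abelianize g s))) ∧
        ∀ u v : surfaceGen g → ℤ, symplForm (F u) (F v) = ε * symplForm u v) →
    (∀ (m : ℕ) (F : (surfaceGen (3 + 3 * m) → ℤ) ≃ₗ[ℤ] (surfaceGen (3 + 3 * m) → ℤ)) (ε : ℤ),
      (ε = 1 ∨ ε = -1) →
      (∀ u v : surfaceGen (3 + 3 * m) → ℤ, symplForm (F u) (F v) = ε * symplForm u v) →
      (Submodule.span ℤ ((fun y => (Pi.single y (1 : ℤ) : surfaceGen (3 + 3 * m) → ℤ)) ''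
          s4CutSystem m 0)).map F.toLinearMap =
        Submodule.span ℤ ((fun y => (Pi.single y (1 : ℤ) : surfaceGen (3 + 3 * m) → ℤ)) ''
          s4CutSystem m 0) →
      (Submodule.span ℤ ((fun y => (Pi.single y (1 : ℤ) : surfaceGen (3 + 3 * m) → ℤ)) ''
          s4CutSystem m 1)).map F.toLinearMap =
        Submodule.span ℤ ((fun y => (Pi.single y (1 : ℤ) : surfaceGen (3 + 3 * m) → ℤ)) ''
          s4CutSystem m 1) →
      ∃ x : SurfaceGroup (3 + 3 * m) ≃* SurfaceGroup (3 + 3 * m),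
        (s4Kernels.stabilizeIter m 0).map x.toMonoidHom = s4Kernels.stabilizeIter m 0 ∧
        (s4Kernels.stabilizeIter m 1).map x.toMonoidHom = s4Kernels.stabilizeIter m 1 ∧
        ∀ s : SurfaceGroup (3 + 3 * m),
          toAdd (SurfaceGroup.abelianize (3 + 3 * m) (x s)) =
            F (toAdd (SurfaceGroup.abelianize (3 + 3 * m) s))) →
    ∀ (m c : ℕ) (K : TrisectionKernels (3 + 3 * m)),
      3 ≤ m ∧ c = 0 →
      IsGroupTrisection (3 + 3 * m) (m + 1) (PUnit : Type) K →
      K 0 = s4Kernels.stabilizeIter m 0 → K 1 = s4Kernels.stabilizeIter m 1 →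
      (∀ i j : Fin 3, i ≠ j → ∃ α : SurfaceGroup (3 + 3 * m) ≃* SurfaceGroup (3 + 3 * m),
        (s4Kernels.stabilizeIter m i).map α.toMonoidHom = K i ∧
          (s4Kernels.stabilizeIter m j).map α.toMonoidHom = K j) →
      (∀ M : Subgroup (SurfaceGroup (3 + 3 * m)), M.Characteristic → M.FiniteIndex →
        ∃ ψ : SurfaceGroup (3 + 3 * m) ≃* SurfaceGroup (3 + 3 * m), ∀ i : Fin 3,
          (s4Kernels.stabilizeIter m i ⊔ M).map ψ.toMonoidHom = K i ⊔ M) →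
      K 2 ⊔ (⊤ : Subgroup (SurfaceGroup (3 + 3 * m))).lowerCentralSeries (c + 1) =
        s4Kernels.stabilizeIter m 2 ⊔ (⊤ : Subgroup (SurfaceGroup (3 + 3 * m))).lowerCentralSeries (c + 1) →
      ∃ y : SurfaceGroup (3 + 3 * m) ≃* SurfaceGroup (3 + 3 * m),
        (s4Kernels.stabilizeIter m 0).map y.toMonoidHom = s4Kernels.stabilizeIter m 0 ∧
        (s4Kernels.stabilizeIter m 1).map y.toMonoidHom = s4Kernels.stabilizeIter m 1 ∧
        (s4Kernels.stabilizeIter m 2 ⊔ (⊤ : Subgroup (SurfaceGroup (3 + 3 * m))).lowerCentralSeries (c + 1 + 1)).map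
            y.toMonoidHom =
          K 2 ⊔ (⊤ : Subgroup (SurfaceGroup (3 + 3 * m))).lowerCentralSeries (c + 1 + 1) := by
  sorry

/-- STUB 3b `stub_layerStepResidualFamily` (RESHAPE r4 of `stub_nilpotentLayerStep`: the layer step at the remaining
`(m,c)`: `(1 ≤ m ∧ 1 ≤ c) ∨ (m = 0 ∧ 4 ≤ c)`; given Stub 2a and Goeritz realisation at all genera. Via the landed
uniform reductions `helper_layerStepOfCore` (p127510) and `map_sup_lcs_eq_of_data` (p110918) it is the crux-INDEPENDENT
Goeritz–Johnson realisation `GJ_{c+1}(m)` for the genus-`3(m+1)` Goeritz group of `#^{m+1} S¹×S²`; no certificate and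
no obstruction known at any of its instances ((0,4) and (1,1) are the next machine-checkable ones); uniform proof unknown
— the line's second residual, honestly open.) -/
theorem stub_layerStepResidualFamily :
    (∀ (g : ℕ) (φ : SurfaceGroup g ≃* SurfaceGroup g),
      ∃ (F : (surfaceGen g → ℤ) ≃ₗ[ℤ] (surfaceGen g → ℤ)) (ε : ℤ), (ε = 1 ∨ ε = -1) ∧
        (∀ s : SurfaceGroup g,
          toAdd (SurfaceGroup.abelianize g (φ s)) = F (toAdd (SurfaceGroup.abelianize g s))) ∧
        ∀ u v : surfaceGen g → ℤ, symplForm (F u) (F v) = ε * symplForm u v) →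
    (∀ (m : ℕ) (F : (surfaceGen (3 + 3 * m) → ℤ) ≃ₗ[ℤ] (surfaceGen (3 + 3 * m) → ℤ)) (ε : ℤ),
      (ε = 1 ∨ ε = -1) →
      (∀ u v : surfaceGen (3 + 3 * m) → ℤ, symplForm (F u) (F v) = ε * symplForm u v) →
      (Submodule.span ℤ ((fun y => (Pi.single y (1 : ℤ) : surfaceGen (3 + 3 * m) → ℤ)) ''
          s4CutSystem m 0)).map F.toLinearMap =
        Submodule.span ℤ ((fun y => (Pi.single y (1 : ℤ) : surfaceGen (3 + 3 * m) → ℤ)) ''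
          s4CutSystem m 0) →
      (Submodule.span ℤ ((fun y => (Pi.single y (1 : ℤ) : surfaceGen (3 + 3 * m) → ℤ)) ''
          s4CutSystem m 1)).map F.toLinearMap =
        Submodule.span ℤ ((fun y => (Pi.single y (1 : ℤ) : surfaceGen (3 + 3 * m) → ℤ)) ''
          s4CutSystem m 1) →
      ∃ x : SurfaceGroup (3 + 3 * m) ≃* SurfaceGroup (3 + 3 * m),
        (s4Kernels.stabilizeIter m 0).map x.toMonoidHom = s4Kernels.stabilizeIter m 0 ∧
        (s4Kernels.stabilizeIter m 1).map x.toMonoidHom = s4Kernels.stabilizeIter m 1 ∧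
        ∀ s : SurfaceGroup (3 + 3 * m),
          toAdd (SurfaceGroup.abelianize (3 + 3 * m) (x s)) =
            F (toAdd (SurfaceGroup.abelianize (3 + 3 * m) s))) →
    ∀ (m c : ℕ) (K : TrisectionKernels (3 + 3 * m)),
      ((1 ≤ m ∧ 1 ≤ c) ∨ (m = 0 ∧ 4 ≤ c)) →
      IsGroupTrisection (3 + 3 * m) (m + 1) (PUnit : Type) K →
      K 0 = s4Kernels.stabilizeIter m 0 → K 1 = s4Kernels.stabilizeIter m 1 →
      (∀ i j : Fin 3, i ≠ j → ∃ α : SurfaceGroup (3 + 3 * m) ≃* SurfaceGroup (3 + 3 * m),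
        (s4Kernels.stabilizeIter m i).map α.toMonoidHom = K i ∧
          (s4Kernels.stabilizeIter m j).map α.toMonoidHom = K j) →
      (∀ M : Subgroup (SurfaceGroup (3 + 3 * m)), M.Characteristic → M.FiniteIndex →
        ∃ ψ : SurfaceGroup (3 + 3 * m) ≃* SurfaceGroup (3 + 3 * m), ∀ i : Fin 3,
          (s4Kernels.stabilizeIter m i ⊔ M).map ψ.toMonoidHom = K i ⊔ M) →
      K 2 ⊔ (⊤ : Subgroup (SurfaceGroup (3 + 3 * m))).lowerCentralSeries (c + 1) =
        s4Kernels.stabilizeIter m 2 ⊔ (⊤ : Subgroup (SurfaceGroup (3 + 3 * m))).lowerCentralSeries (c + 1) →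
      ∃ y : SurfaceGroup (3 + 3 * m) ≃* SurfaceGroup (3 + 3 * m),
        (s4Kernels.stabilizeIter m 0).map y.toMonoidHom = s4Kernels.stabilizeIter m 0 ∧
        (s4Kernels.stabilizeIter m 1).map y.toMonoidHom = s4Kernels.stabilizeIter m 1 ∧
        (s4Kernels.stabilizeIter m 2 ⊔ (⊤ : Subgroup (SurfaceGroup (3 + 3 * m))).lowerCentralSeries (c + 1 + 1)).map
            y.toMonoidHom =
          K 2 ⊔ (⊤ : Subgroup (SurfaceGroup (3 + 3 * m))).lowerCentralSeries (c + 1 + 1) := by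
  sorry

/-- STUB 4 `stub_johnsonClosedGate` (Johnson-closed gate; the LOAD-BEARING residual, open-problem;
held by the lead). -/
theorem stub_johnsonClosedGate :
    ∀ (m : ℕ) (K : TrisectionKernels (3 + 3 * m)),
      IsGroupTrisection (3 + 3 * m) (m + 1) (PUnit : Type) K →
      K 0 = s4Kernels.stabilizeIter m 0 → K 1 = s4Kernels.stabilizeIter m 1 →
      (∀ i j : Fin 3, i ≠ j → ∃ α : SurfaceGroup (3 + 3 * m) ≃* SurfaceGroup (3 + 3 * m),
        (s4Kernels.stabilizeIter m i).map α.toMonoidHom = K i ∧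
          (s4Kernels.stabilizeIter m j).map α.toMonoidHom = K j) →
      (∀ M : Subgroup (SurfaceGroup (3 + 3 * m)), M.Characteristic → M.FiniteIndex →
        ∃ ψ : SurfaceGroup (3 + 3 * m) ≃* SurfaceGroup (3 + 3 * m), ∀ i : Fin 3,
          (s4Kernels.stabilizeIter m i ⊔ M).map ψ.toMonoidHom = K i ⊔ M) →
      (∀ c : ℕ, ∃ x : SurfaceGroup (3 + 3 * m) ≃* SurfaceGroup (3 + 3 * m),
        (s4Kernels.stabilizeIter m 0).map x.toMonoidHom = s4Kernels.stabilizeIter m 0 ∧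
        (s4Kernels.stabilizeIter m 1).map x.toMonoidHom = s4Kernels.stabilizeIter m 1 ∧
        (s4Kernels.stabilizeIter m 2 ⊔ (⊤ : Subgroup (SurfaceGroup (3 + 3 * m))).lowerCentralSeries (c + 1)).map
            x.toMonoidHom =
          K 2 ⊔ (⊤ : Subgroup (SurfaceGroup (3 + 3 * m))).lowerCentralSeries (c + 1)) →
      TrisectionKernels.Iso (s4Kernels.stabilizeIter m) K := by
  sorry

/-! ## 3. The stubs in the line's named form (definitional read-backs, no content) -/

/-- Stub 1 read back. -/
theorem abelianGenusClass : AbelianGenusClass :=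
  Summit.SmoothPoincare4.SmoothPoincare4.Theorems.ShadowApproximation.NilpotentGenusClass.stub_abelianGenusClass

/-- Stub 2a read back. -/
theorem autSymplectic : AutSymplectic :=
  Summit.SmoothPoincare4.SmoothPoincare4.Theorems.ShadowApproximation.NilpotentGenusClass.stub_autAbelianizeSymplectic

/-- Stubs 2b + 2c read back: Goeritz realisation at every genus `3 + 3m`. -/
theorem goeritzRealisation : ∀ m : ℕ, GoeritzRealisation m := by
  intro m
  rcases Nat.eq_zero_or_pos m with rfl | hm
  · exact Summit.SmoothPoincare4.SmoothPoincare4.Theorems.ShadowApproximation.NilpotentGenusClass.stub_goeritzRealisationThree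
  · exact Summit.SmoothPoincare4.SmoothPoincare4.Theorems.ShadowApproximation.NilpotentGenusClass.stub_goeritzRealisationPos
      Summit.SmoothPoincare4.SmoothPoincare4.Theorems.ShadowApproximation.NilpotentGenusClass.stub_goeritzRealisationThree m hm

/-- Stubs 3a + 3b read back: the layer step at every `(m, c)`. -/
theorem layerStepAt : ∀ m c : ℕ, LayerStepAt m c := by
  intro m c
  rcases Nat.lt_or_ge m 3 with hm | hm
  · interval_cases m
    · -- m = 0
      rcases Nat.lt_or_ge c 4 with hc | hc
      · interval_cases c
        · exact Summit.SmoothPoincare4.SmoothPoincare4.Theorems.ShadowApproximation.NilpotentGenusClass.stub_layerStepZero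
            autSymplectic Summit.SmoothPoincare4.SmoothPoincare4.Theorems.ShadowApproximation.NilpotentGenusClass.stub_goeritzRealisationThree
        · exact Summit.SmoothPoincare4.SmoothPoincare4.Theorems.ShadowApproximation.NilpotentGenusClass.stub_layerStepZeroOne autSymplectic
            goeritzRealisation
        · exact Summit.SmoothPoincare4.SmoothPoincare4.Theorems.ShadowApproximation.NilpotentGenusClass.stub_layerStepZeroTwo autSymplectic
            goeritzRealisation
        · exact stub_layerStepZeroThree autSymplectic goeritzRealisation
      · exact fun K => stub_layerStepResidualFamily autSymplectic goeritzRealisation 0 c K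
          (Or.inr ⟨rfl, hc⟩)
    · -- m = 1
      rcases Nat.eq_zero_or_pos c with rfl | hc
      · exact Summit.SmoothPoincare4.SmoothPoincare4.Theorems.ShadowApproximation.NilpotentGenusClass.stub_layerStepOneZero autSymplectic
          goeritzRealisation
      · exact fun K => stub_layerStepResidualFamily autSymplectic goeritzRealisation 1 c K
          (Or.inl ⟨le_rfl, hc⟩)
    · -- m = 2
      rcases Nat.eq_zero_or_pos c with rfl | hc
      · exact Summit.SmoothPoincare4.SmoothPoincare4.Theorems.ShadowApproximation.NilpotentGenusClass.stub_layerStepTwoZero autSymplectic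
          goeritzRealisation
      · exact fun K => stub_layerStepResidualFamily autSymplectic goeritzRealisation 2 c K
          (Or.inl ⟨by decide, hc⟩)
  · rcases Nat.eq_zero_or_pos c with rfl | hc
    · exact fun K => stub_layerStepBlockZero autSymplectic goeritzRealisation m 0 K ⟨hm, rfl⟩
    · exact fun K => stub_layerStepResidualFamily autSymplectic goeritzRealisation m c K
        (Or.inl ⟨le_trans (by decide) hm, hc⟩)

/-- Stub 4 read back. -/
theorem johnsonClosedGate : JohnsonClosedGate := stub_johnsonClosedGate

/-! ## 4. Glue at the abelian level (sorry-free): from `φ` (Stub 1) to a Goeritz element `x₀` -/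

/-- The image in `H₁` of `P.map ψ` is `F` applied to the image of `P`, when `ψ` induces `F`. -/
theorem span_image_map (ψ : S m ≃* S m) (F : H m ≃ₗ[ℤ] H m) (hF : ∀ s, ab m (ψ s) = F (ab m s))
    (P : Subgroup (S m)) :
    Submodule.span ℤ (ab m '' (P.map ψ.toMonoidHom : Set (S m))) =
      (Submodule.span ℤ (ab m '' (P : Set (S m)))).map F.toLinearMap := by
  rw [Submodule.map_span]
  congr 1
  ext v
  constructor
  · rintro ⟨_, ⟨s, hs, rfl⟩, rfl⟩
    exact ⟨ab m s, ⟨s, hs, rfl⟩, (hF s).symm⟩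
  · rintro ⟨_, ⟨s, hs, rfl⟩, rfl⟩
    exact ⟨ψ s, ⟨s, hs, rfl⟩, hF s⟩

/-- `γ₂ = ker ab` is invisible in `H₁`: the image of `P ⊔ γ₂` spans the same as the image of `P`. -/
theorem span_image_sup_γ (P : Subgroup (S m)) :
    Submodule.span ℤ (ab m '' ((P ⊔ γ m 0 : Subgroup (S m)) : Set (S m))) =
      Submodule.span ℤ (ab m '' (P : Set (S m))) := by
  have h := SurfaceGroup.span_image_sup (g := 3 + 3 * m) P (γ m 0)
  have h0 : Submodule.span ℤ (ab m '' ((γ m 0 : Subgroup (S m)) : Set (S m))) = ⊥ := by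
    rw [Submodule.span_eq_bot]
    rintro _ ⟨s, hs, rfl⟩
    have hs' : s ∈ (SurfaceGroup.abelianize (3 + 3 * m)).ker := by
      rw [SurfaceGroup.ker_abelianize_eq_lowerCentralSeries]; exact hs
    rw [MonoidHom.mem_ker] at hs'
    change toAdd (SurfaceGroup.abelianize (3 + 3 * m) s) = 0
    rw [hs', toAdd_one]
  change Submodule.span ℤ (ab m '' ((P ⊔ γ m 0 : Subgroup (S m)) : Set (S m))) =
    Submodule.span ℤ (ab m '' (P : Set (S m))) ⊔ Submodule.span ℤ (ab m '' ((γ m 0 : Subgroup (S m)) : Set (S m))) at h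
  rw [h, h0, sup_bot_eq]

/-- The abelian shadow of the standard kernel `N m i` is the coordinate Lagrangian `Λ m i`
(the landed `span_image_stabilizeIter`). -/
theorem span_image_N (m : ℕ) (i : Fin 3) :
    Submodule.span ℤ (ab m '' ((N m i : Subgroup (S m)) : Set (S m))) = Λ m i :=
  Summit.SmoothPoincare4.SmoothPoincare4.Theorems.AbelianShadowStandard.span_image_stabilizeIter m i

/-- If `φ` induces `F` on `H₁` and stabilises `N m i · γ₂`, then `F` stabilises `Λ m i`. -/
theorem map_Λ_of_map_sup (φ : S m ≃* S m) (F : H m ≃ₗ[ℤ] H m) (hF : ∀ s, ab m (φ s) = F (ab m s))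
    (i : Fin 3) (h : (N m i ⊔ γ m 0).map φ.toMonoidHom = N m i ⊔ γ m 0) :
    (Λ m i).map F.toLinearMap = Λ m i := by
  have e : Submodule.span ℤ (ab m '' (((N m i ⊔ γ m 0).map φ.toMonoidHom : Subgroup (S m)) : Set (S m))) =
      Submodule.span ℤ (ab m '' ((N m i ⊔ γ m 0 : Subgroup (S m)) : Set (S m))) := by rw [h]
  rw [span_image_map φ F hF, span_image_sup_γ, span_image_N] at e
  exact e

/-- If `x` and `φ` induce the same map on `H₁` then `x ≡ φ (mod γ₂)`. -/
theorem congr_of_ab_eq (x φ : S m ≃* S m) (h : ∀ s, ab m (x s) = ab m (φ s)) :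
    ∀ s, x s * (φ s)⁻¹ ∈ γ m 0 := by
  intro s
  have hk : x s * (φ s)⁻¹ ∈ (SurfaceGroup.abelianize (3 + 3 * m)).ker := by
    rw [MonoidHom.mem_ker, map_mul, map_inv]
    have h' : SurfaceGroup.abelianize (3 + 3 * m) (x s) = SurfaceGroup.abelianize (3 + 3 * m) (φ s) :=
      toAdd.injective (h s)
    rw [h', mul_inv_cancel]
  rwa [SurfaceGroup.ker_abelianize_eq_lowerCentralSeries] at hk

/-- **The abelian level** from Stubs 1, 2a, 2b/2c: a Goeritz element `x₀ ∈ A∩B` with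
`x₀(N 2)·γ₂ = K 2·γ₂`. -/
theorem levelSolution_zero (h₁ : AbelianGenusClass) (h₂ : AutSymplectic)
    (hR : ∀ m, GoeritzRealisation m) (m : ℕ) (K : TrisectionKernels (3 + 3 * m))
    (hK : IsGroupTrisection (3 + 3 * m) (m + 1) (PUnit : Type) K) (h0 : K 0 = N m 0)
    (h1 : K 1 = N m 1) : LevelSolution m 0 K := by
  -- arithmetic: genus = class at the abelian level
  obtain ⟨φ, hφ0, hφ1, hφ2⟩ := h₁ m K hK h0 h1
  -- `φ̄` is a `±`-isometry `F` of `H₁` …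
  obtain ⟨F, ε, hε, hF, hiso⟩ := h₂ (3 + 3 * m) φ
  -- … stabilising `Λ₀`, `Λ₁`
  have hΛ0 : (Λ m 0).map F.toLinearMap = Λ m 0 := map_Λ_of_map_sup φ F hF 0 hφ0
  have hΛ1 : (Λ m 1).map F.toLinearMap = Λ m 1 := map_Λ_of_map_sup φ F hF 1 hφ1
  -- Goeritz: realise `F` by `x ∈ A∩B`; then `x ≡ φ (mod γ₂)`
  obtain ⟨x, hx0, hx1, hx⟩ := hR m F ε hε hiso hΛ0 hΛ1
  have hcong : ∀ s, x s * (φ s)⁻¹ ∈ γ m 0 :=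
    congr_of_ab_eq x φ fun s => (hx s).trans (hF s).symm
  refine ⟨x, hx0, hx1, ?_⟩
  rw [Subgroup.map_sup, map_γ] at hφ2
  rw [Subgroup.map_sup, map_γ, map_sup_congr hcong, hφ2]

/-! ## 5. Composition (sorry-free glue) -/

/-- **All levels from the abelian level and the layer steps** (induction on `c`, transporting `K`
along the level-`c` solution before applying the step and composing afterwards). -/
theorem levelSolution_all (h₁ : AbelianGenusClass) (h₂ : AutSymplectic)
    (hR : ∀ m, GoeritzRealisation m) (h₃ : ∀ m c, LayerStepAt m c) (m : ℕ) :
    ∀ (c : ℕ) (K : TrisectionKernels (3 + 3 * m)),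
      IsGroupTrisection (3 + 3 * m) (m + 1) (PUnit : Type) K → K 0 = N m 0 → K 1 = N m 1 →
      Pairs m K → Shadows m K → LevelSolution m c K := by
  intro c
  induction c with
  | zero =>
    intro K hK h0 h1 _ _
    exact levelSolution_zero h₁ h₂ hR m K hK h0 h1
  | succ c ih =>
    intro K hK h0 h1 hW hS
    obtain ⟨x, hx0, hx1, hx2⟩ := ih K hK h0 h1 hW hS
    -- transport `K` along `x⁻¹`: slot 2 becomes standard modulo `γ m c`
    have hK' : IsGroupTrisection (3 + 3 * m) (m + 1) (PUnit : Type)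
        (fun i => (K i).map x.symm.toMonoidHom) := isGroupTrisection_map hK x.symm
    have h0' : (fun i => (K i).map x.symm.toMonoidHom) 0 = N m 0 := by
      show (K 0).map x.symm.toMonoidHom = N m 0
      rw [h0]
      exact map_symm_of_map x hx0
    have h1' : (fun i => (K i).map x.symm.toMonoidHom) 1 = N m 1 := by
      show (K 1).map x.symm.toMonoidHom = N m 1
      rw [h1]
      exact map_symm_of_map x hx1
    have h2' : (fun i => (K i).map x.symm.toMonoidHom) 2 ⊔ γ m c = N m 2 ⊔ γ m c := by
      show (K 2).map x.symm.toMonoidHom ⊔ γ m c = N m 2 ⊔ γ m c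
      have e := congrArg (Subgroup.map x.symm.toMonoidHom) hx2
      rw [map_map_symm, Subgroup.map_sup, map_γ] at e
      exact e.symm
    -- the layer step on the transported triple
    obtain ⟨y, hy0, hy1, hy2⟩ :=
      h₃ m c _ hK' h0' h1' (pairs_transport x.symm hW) (shadows_transport x.symm hS) h2'
    have hy2' : (N m 2 ⊔ γ m (c + 1)).map y.toMonoidHom =
        (K 2).map x.symm.toMonoidHom ⊔ γ m (c + 1) := hy2
    -- compose: `x ∘ y`
    refine ⟨y.trans x, ?_, ?_, ?_⟩
    · rw [map_trans, hy0, hx0]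
    · rw [map_trans, hy1, hx1]
    · rw [map_trans, hy2', Subgroup.map_sup, map_γ, map_symm_map]

/-- **The slot-normalised crux from the parts** (pure logic): all levels, then the Johnson-closed
gate. -/
theorem normalised_of_parts (h₁ : AbelianGenusClass) (h₂ : AutSymplectic)
    (hR : ∀ m, GoeritzRealisation m) (h₃ : ∀ m c, LayerStepAt m c) (h₄ : JohnsonClosedGate)
    (m : ℕ) (K : TrisectionKernels (3 + 3 * m))
    (hK : IsGroupTrisection (3 + 3 * m) (m + 1) (PUnit : Type) K) (h0 : K 0 = N m 0)
    (h1 : K 1 = N m 1) (hW : Pairs m K) (hS : Shadows m K) : TrisectionKernels.Iso (N m) K :=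
  h₄ m K hK h0 h1 hW hS fun c => levelSolution_all h₁ h₂ hR h₃ m c K hK h0 h1 hW hS

/-- **The crux from the parts, as an implication** (pure logic, kernel-checked): normalise slots
`0, 1` with the automorphism supplied by the crux's own hypothesis `hW 0 1` (transporting
`IsGroupTrisection`, `Pairs`, `Shadows` along `α⁻¹`), apply `normalised_of_parts`, undo `α`. -/
theorem iso_of_parts (h₁ : AbelianGenusClass) (h₂ : AutSymplectic)
    (hR : ∀ m, GoeritzRealisation m) (h₃ : ∀ m c, LayerStepAt m c) (h₄ : JohnsonClosedGate) :
    ∀ (m : ℕ) (K : TrisectionKernels (3 + 3 * m)),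
      IsGroupTrisection (3 + 3 * m) (m + 1) (PUnit : Type) K → Pairs m K → Shadows m K →
        TrisectionKernels.Iso (N m) K := by
  intro m K hK hW hS
  obtain ⟨α, hα0, hα1⟩ := hW 0 1 (by decide)
  exact iso_transport α
    (normalised_of_parts h₁ h₂ hR h₃ h₄ m (fun i => (K i).map α.symm.toMonoidHom)
      (isGroupTrisection_map hK α.symm) (map_symm_of_map α hα0) (map_symm_of_map α hα1)
      (pairs_transport α.symm hW) (shadows_transport α.symm hS))

/-- **Composition.** The seven registered stubs prove the crux `CongruenceShadows.ShadowApproximation`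
BY NAME. -/
theorem ShadowApproximation_of :
    _root_.Summit.SmoothPoincare4.SmoothPoincare4.Theses.CongruenceShadows.ShadowApproximation :=
  fun m K hK hW hS => iso_of_parts abelianGenusClass autSymplectic goeritzRealisation layerStepAt
    johnsonClosedGate m K hK hW hS

/-! ## 6. Certificates (sorry-free): Disproof §3 honoured — Stub 4 needs `IsGroupTrisection ∧ Pairs`

The landed junk triple `J = (N₀, N₁, J₂)`, `J₂ = N₂ ⊓ ker θ` (`Negative/ShadowsOnlyFalse.lean`,
p73171) has standard NILPOTENT shadows at every level with the identity as level solution: since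
`θ[s_h, b₀] = θ b₀` with `s_h ∈ N₂`, the generator `b₀` lies in `⁅N₂,N₂⁆·J₂` (and `a₁, a₂ ∈ J₂`), so
`N₂ ≤ ⁅N₂,N₂⁆·J₂`, i.e. `N₂/J₂` is perfect, hence `N₂ ≤ J₂·γₙS` for every `n`. So `J` satisfies every
hypothesis of `JohnsonClosedGate` except `IsGroupTrisection` / `Pairs`, and `¬ Iso N J`: the residual
stub is false without them, and any proof of it must use the freeness of `S/K 2`. -/

section junk

open scoped commutatorElement

open Summit.SmoothPoincare4.SmoothPoincare4.Theorems.ShadowApproximation.Negative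
  (theta thetaGen theta_of sh cyc hPerm J2 junk theta_b0 theta_sh hPerm_mul_cyc b0_mem_N2 J2_le
    not_iso_junk junk_normal junk_shadows)

/-- `s_h ∈ N₂` (a product of conjugates of `b₀ ∈ N₂`). -/
theorem sh_mem_N2 : sh ∈ s4Kernels 2 := by
  have hb := b0_mem_N2
  have n : (s4Kernels 2).Normal := inferInstance
  rw [sh]
  refine Subgroup.mul_mem _ (Subgroup.mul_mem _ ?_ ?_) hb
  · have := n.conj_mem _ hb ((SurfaceGroup.b 1)⁻¹ * (SurfaceGroup.b 1)⁻¹)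
    simpa [mul_assoc] using this
  · have := n.conj_mem _ hb ((SurfaceGroup.b 1)⁻¹)
    simpa [mul_assoc] using this

/-- `θ[s_h, b₀] = θ b₀`: the 3-cycle `(0 1 2)` is a commutator inside `θ(N₂)`. -/
theorem theta_comm_sh_b0 :
    theta ⁅sh, (SurfaceGroup.b 0 : SurfaceGroup 3)⁆ = theta (SurfaceGroup.b 0) := by
  rw [commutatorElement_def, map_mul, map_mul, map_mul, map_inv, map_inv, theta_sh, theta_b0,
    hPerm_mul_cyc]
  simp [mul_assoc]

/-- `b₀ ∈ ⁅N₂,N₂⁆ ⊔ J₂`. -/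
theorem b0_mem_commutator_sup_J2 :
    SurfaceGroup.b 0 ∈ ⁅s4Kernels 2, s4Kernels 2⁆ ⊔ J2 := by
  have hc : ⁅sh, (SurfaceGroup.b 0 : SurfaceGroup 3)⁆ ∈ ⁅s4Kernels 2, s4Kernels 2⁆ :=
    Subgroup.commutator_mem_commutator sh_mem_N2 b0_mem_N2
  have hcN : ⁅sh, (SurfaceGroup.b 0 : SurfaceGroup 3)⁆ ∈ s4Kernels 2 :=
    Subgroup.commutator_le_right (s4Kernels 2) (s4Kernels 2) hc
  have hj : (⁅sh, (SurfaceGroup.b 0 : SurfaceGroup 3)⁆)⁻¹ * SurfaceGroup.b 0 ∈ J2 := by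
    refine Subgroup.mem_inf.2 ⟨Subgroup.mul_mem _ (Subgroup.inv_mem _ hcN) b0_mem_N2, ?_⟩
    rw [MonoidHom.mem_ker, map_mul, map_inv, theta_comm_sh_b0, inv_mul_cancel]
  have e : SurfaceGroup.b 0 =
      ⁅sh, (SurfaceGroup.b 0 : SurfaceGroup 3)⁆ *
        ((⁅sh, (SurfaceGroup.b 0 : SurfaceGroup 3)⁆)⁻¹ * SurfaceGroup.b 0) := by
    rw [mul_inv_cancel_left]
  rw [e]
  exact Subgroup.mul_mem_sup hc hj

/-- `N₂ ≤ ⁅N₂,N₂⁆ ⊔ J₂`, i.e. `N₂/J₂ (≅ θ(N₂) = Alt_fin ℤ)` is perfect — checked on the three normal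
generators `b₀, a₁, a₂` of `N₂`. -/
theorem N2_le_commutator_sup_J2 : s4Kernels 2 ≤ ⁅s4Kernels 2, s4Kernels 2⁆ ⊔ J2 := by
  have key : Subgroup.normalClosure (PresentedGroup.of '' (s4Gens 2 : Set (surfaceGen 3))) ≤
      ⁅s4Kernels 2, s4Kernels 2⁆ ⊔ J2 := by
    refine Subgroup.normalClosure_le_normal ?_
    rintro _ ⟨p, hp, rfl⟩
    have hp' : p ∈ s4Gens 2 := hp
    have hgen : ∀ q : surfaceGen 3, q ∈ s4Gens 2 → thetaGen q = 1 →
        (PresentedGroup.of q : SurfaceGroup 3) ∈ ⁅s4Kernels 2, s4Kernels 2⁆ ⊔ J2 := by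
      intro q hq hθ
      refine Subgroup.mem_sup_right (Subgroup.mem_inf.2 ⟨of_mem_s4Kernels 2 hq, ?_⟩)
      rw [MonoidHom.mem_ker, theta_of, hθ]
    obtain ⟨i, b⟩ := p
    fin_cases i <;> cases b <;>
      first
      | exact absurd hp' (by decide)
      | exact b0_mem_commutator_sup_J2
      | exact hgen _ hp' (by simp [thetaGen])
  exact le_trans (le_of_eq (s4Kernels_eq 2)) key

/-- `N₂ ≤ J₂ ⊔ γₙ(S₃)` for every `n`: a perfect section lies in every term of the lower central
series (computed in `S₃ ⧸ J₂` and pulled back). -/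
theorem N2_le_J2_sup_lcs (n : ℕ) :
    s4Kernels 2 ≤ J2 ⊔ (⊤ : Subgroup (SurfaceGroup 3)).lowerCentralSeries n := by
  have hsurj : Function.Surjective (QuotientGroup.mk' J2) := QuotientGroup.mk'_surjective J2
  have hP : (s4Kernels 2).map (QuotientGroup.mk' J2) ≤
      ⁅(s4Kernels 2).map (QuotientGroup.mk' J2), (s4Kernels 2).map (QuotientGroup.mk' J2)⁆ := by
    have := Subgroup.map_mono (f := QuotientGroup.mk' J2) N2_le_commutator_sup_J2
    rwa [Subgroup.map_sup, Subgroup.map_commutator, QuotientGroup.map_mk'_self, sup_bot_eq] at this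
  have hlcs : ∀ k, (s4Kernels 2).map (QuotientGroup.mk' J2) ≤
      (⊤ : Subgroup (SurfaceGroup 3 ⧸ J2)).lowerCentralSeries k := by
    intro k
    induction k with
    | zero => exact le_top
    | succ k ih =>
      rw [Subgroup.lowerCentralSeries_succ]
      exact hP.trans (Subgroup.commutator_mono ih le_top)
  have h1 : s4Kernels 2 ≤
      (((⊤ : Subgroup (SurfaceGroup 3)).lowerCentralSeries n).map (QuotientGroup.mk' J2)).comap
        (QuotientGroup.mk' J2) := by
    rw [Subgroup.map_lowerCentralSeries, Subgroup.map_top_of_surjective _ hsurj]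
    exact fun x hx => Subgroup.mem_comap.2 (hlcs n (Subgroup.mem_map_of_mem _ hx))
  rw [Subgroup.comap_map_eq, QuotientGroup.ker_mk', sup_comm] at h1
  exact h1

/-- **The junk triple has the identity as level-`c` solution for every `c`** (standard nilpotent
shadows at all levels, exact slots `0, 1`). -/
theorem junk_levelSolution (c : ℕ) : LevelSolution 0 c junk := by
  refine ⟨MulEquiv.refl _, by simp, by simp, ?_⟩
  have e : (N 0 2 ⊔ γ 0 c).map (MulEquiv.refl (S 0)).toMonoidHom = N 0 2 ⊔ γ 0 c := by simp
  rw [e]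
  show s4Kernels 2 ⊔ γ 0 c = J2 ⊔ γ 0 c
  exact le_antisymm (sup_le (N2_le_J2_sup_lcs (c + 1)) le_sup_right) (sup_le_sup_right J2_le _)

/-- **Disproof §3 at Stub 4: `JohnsonClosedGate` is FALSE without `IsGroupTrisection ∧ Pairs`.**
Keeping normality of the kernels, the literal slot normalisation, the shadow hypothesis VERBATIM and
level solutions at EVERY nilpotent level, `Iso` still fails (junk triple, `m = 0`). -/
theorem johnsonClosedGate_false_without_isGroupTrisection :
    ¬ ∀ (m : ℕ) (K : TrisectionKernels (3 + 3 * m)), (∀ i, (K i).Normal) → K 0 = N m 0 →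
      K 1 = N m 1 → Shadows m K → (∀ c : ℕ, LevelSolution m c K) →
      TrisectionKernels.Iso (N m) K := by
  intro h
  refine not_iso_junk (h 0 junk junk_normal rfl rfl (fun M hM hF => ⟨MulEquiv.refl _, fun i => ?_⟩)
    junk_levelSolution)
  haveI := hM
  haveI := hF
  haveI : M.Normal := inferInstance
  change (s4Kernels i ⊔ M).map (MulEquiv.refl (SurfaceGroup 3)).toMonoidHom = junk i ⊔ M
  simpa using junk_shadows M i

end junk

end Summit.SmoothPoincare4.SmoothPoincare4.Cruxes.ShadowApproximation.NilpotentGenusClass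

end
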